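import Summits.AtomisticToContinuum.BoseEinsteinCondensation.Theorems.BECCutLineWeakDisorderWitnessTransferLevelSet
import Summits.AtomisticToContinuum.BoseEinsteinCondensation.Theorems.BECCutLineWeakDisorderWitnessTransferHardSetMargin
import Summits.AtomisticToContinuum.BoseEinsteinCondensation.Theorems.BECCutLineWeakDisorderWitnessTransferConvergence
import Literature.MathematicalPhysics.QuantumManyBody.GroundStateFeynmanKacTrialState
import HarnessLib

/-!
# Route `BECCutLineWeakDisorder`, crux `TwoReplicaTransienceBound` (stmt-AtomisticToContinuum-9687), line
# `late-core-split`: the landscape witness at LATE polymer length (toolbox stub `stub_glueLandscapeAtLate`)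

Support file (`--supports stmt-AtomisticToContinuum-9687`; lead c7 adopting the crux strategist's line
`Cruxes/TwoReplicaTransienceBound/Lines/late_core_split.lean`). `Goal.stub_glueLandscapeAtLate` is the
registered SIGNATURE of the toolbox stub (a statement, nothing asserted; kept next to its proof so
that `…LateCoreSplitDefs.lean` does not import the `WitnessTransfer` machinery); `stub_glueLandscapeAtLate`
is its PROOF. Statement = the landed `CutLineWitness.glue_landscape_at` (`…WitnessTransferFiniteT.lean`;
parts (B), (C), (E1a), (E1b), (F), (E2) of crux `WitnessTransfer` as hypotheses) with ONE change: the
two-replica bound `R_L(Ψ_T) ≤ C` is assumed for `T ≥ T₁` only (`T₁ ≥ 1` arbitrary). The original uses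
the bound at one late `T = max 1 (2ℓ/δ + 1)` (strategist census §1(i)); here `T = max T₁ (2ℓ/δ + 1)`
and the proof is verbatim otherwise. Consumer: `stub_lateWitnessTransfer : LateTwoReplicaBound →
LandscapeBound` (`…LateCoreSplitLateWitnessTransfer.lean`) — the route's hinge from the LATE bound alone.
-/

noncomputable section

open MeasureTheory Filter Set Metric
open scoped ENNReal NNReal Topology

namespace Summit.AtomisticToContinuum.BoseEinsteinCondensation.Cruxes.TwoReplicaTransienceBound.LateCoreSplit

open Literature.MathematicalPhysics.QuantumManyBody.BoseGas
open Summit.AtomisticToContinuum.BoseEinsteinCondensation.Theorems.CutLineWitness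

namespace Goal
/-- Registered toolbox stub `stub_glueLandscapeAtLate` (signature): the landscape witness at LATE
polymer length, fixed `(n, L, δ)` — `glue_landscape_at` with `hrat : ∀ T ≥ T₁` (`T₁ ≥ 1`). -/
abbrev stub_glueLandscapeAtLate : Prop :=
  ∀ (HB : ∀ {N : ℕ} {v : ℝ → ℝ≥0∞} (_ : Measurable v) (L : ℝ) {T : ℝ} (_ : 0 < T)
      (_ : fkNormSq (N := N) v L T (fun _ => 1) ≠ 0) {t : ℝ} (_ : 0 < t),
      Real.exp (-(Real.log ((fkNormSq (N := N) v L 0 (fun _ => 1)).toReal /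
          (fkNormSq (N := N) v L T (fun _ => 1)).toReal) / (2 * T) * t)) ≤
        ∫ X, fkWitness (N := N) v L T (fun _ => (1 : ℝ≥0∞)) X *
          fkReal v L t (fkWitness (N := N) v L T (fun _ => (1 : ℝ≥0∞))) X)
    (HC : ∀ {N : ℕ} {v : ℝ → ℝ≥0∞} (_ : Measurable v) {L : ℝ} (_ : 0 < L) (_ : 1 ≤ N)
      (_ : groundStateEnergy v N L ≠ ⊤),
      ∃ c : ℝ, 0 < c ∧ ∀ T : ℝ, 0 ≤ T →
        ENNReal.ofReal (c * Real.exp (-(2 * (groundStateEnergy v N L).toReal * T))) ≤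
          fkNormSq (N := N) v L T (fun _ => 1))
    (HE1a : ∀ {N : ℕ} {v : ℝ → ℝ≥0∞} (_ : Measurable v) {L : ℝ} (_ : 0 < L)
      {Ψ : Config N → ℝ} (_ : Measurable Ψ) {M : ℝ} (_ : ∀ X, |Ψ X| ≤ M) (_ : ∀ X, 0 ≤ Ψ X)
      (_ : ∀ X, X ∉ boxN N L → Ψ X = 0) (_ : ∫ X, Ψ X ^ 2 = 1) {E : ℝ}
      (_ : ∀ t : ℝ, 0 < t → Real.exp (-(E * t)) ≤ ∫ X, Ψ X * fkReal v L t Ψ X),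
      (∫⁻ X, ENNReal.ofReal (Ψ X ^ 2) * interaction v X) ≤ ENNReal.ofReal E ∧
      ∀ ε : ℝ, 0 < ε → ∀ᶠ t : ℝ≥0 in 𝓝[>] 0, (ENNReal.ofReal (2 * t))⁻¹ * sqIncr t Ψ ≤
        ENNReal.ofReal (E - (∫⁻ X, ENNReal.ofReal (Ψ X ^ 2) * interaction v X).toReal + ε))
    (HE1b : ∀ {N : ℕ} {v : ℝ → ℝ≥0∞} (_ : Measurable v) {L : ℝ} (_ : 0 < L)
      {f : Config N → ℝ} (_ : Measurable f) {M : ℝ} (_ : ∀ X, |f X| ≤ M) (_ : ∀ X, 0 ≤ f X)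
      (_ : ∀ (σ : Equiv.Perm (Fin N)) (X : Config N), f (X ∘ σ) = f X)
      (_ : 0 < ∫ X, f X ^ 2)
      {S : Set (Config N)} (_ : MeasurableSet S) (_ : S ⊆ boxN N L) {r₀ : ℝ} (_ : 0 < r₀)
      (_ : ∀ X, f X ≠ 0 → Metric.closedBall X r₀ ⊆ S)
      (_ : ∫⁻ X in S, interaction v X ≠ ⊤)
      {K : ℝ} (_ : 0 ≤ K)
      (_ : ∀ ε : ℝ, 0 < ε → ∀ᶠ t : ℝ≥0 in 𝓝[>] 0,
        (ENNReal.ofReal (2 * t))⁻¹ * sqIncr t f ≤ ENNReal.ofReal (K + ε))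
      {ε : ℝ} (_ : 0 < ε),
      ∃ r₁ : ℝ, 0 < r₁ ∧ ∀ (r : ℝ) (hr : 0 < r), r < r₁ → ∃ (c : ℝ) (Φ : TrialState N L),
        0 < c ∧ c ^ 2 * ∫ X, f X ^ 2 ≤ 1 + ε ∧
        (Φ.ψ = fun X => (((c * mollify hr f X : ℝ)) : ℂ)) ∧
        energy v Φ ≤ ENNReal.ofReal (c ^ 2) *
          (ENNReal.ofReal K + (∫⁻ X, ENNReal.ofReal (f X ^ 2) * interaction v X) +
            ENNReal.ofReal ε))
    (HF : ∀ {n : ℕ} {L : ℝ} {f : Config (n + 1) → ℝ} (_ : Measurable f) {M : ℝ}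
      (_ : ∀ X, |f X| ≤ M) (_ : ∀ X, 0 ≤ f X) {r₀ : ℝ} (_ : 0 < r₀)
      (_ : ∀ X, f X ≠ 0 → Metric.closedBall X r₀ ⊆ boxN (n + 1) L)
      {ε : ℝ≥0∞} (_ : 0 < ε),
      ∃ᶠ r in 𝓝[>] (0 : ℝ), ∀ hr : 0 < r,
        ∫⁻ Y : Config n, ENNReal.ofReal (L ^ 3) *
            (∫⁻ x, (‖mollify hr f (Matrix.vecCons x Y)‖₊ : ℝ≥0∞) ^ 2) ^ 2 /
              (∫⁻ x, (‖mollify hr f (Matrix.vecCons x Y)‖₊ : ℝ≥0∞)) ^ 2 ≤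
          (∫⁻ Y : Config n, ENNReal.ofReal (L ^ 3) *
            (∫⁻ x, (‖f (Matrix.vecCons x Y)‖₊ : ℝ≥0∞) ^ 2) ^ 2 /
              (∫⁻ x, (‖f (Matrix.vecCons x Y)‖₊ : ℝ≥0∞)) ^ 2) + ε)
    {v : ℝ → ℝ≥0∞} (hv : IsRepulsiveFiniteRange v)
    (HE2 : ∀ {N : ℕ} (L : ℝ) {T : ℝ} (_ : 0 < T) {η : ℝ} (_ : 0 < η),
      ∃ κ : ℝ, 0 < κ ∧ ∀ X : Config N,
        (∃ i j : Fin N, i ≠ j ∧ ∃ z ∈ hardVec v, dist (X i - X j) z < κ) →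
          fkSemigroup v L T (fun _ => (1 : ℝ≥0∞)) X ≤ ENNReal.ofReal η)
    {n : ℕ} {L : ℝ} (hL : 0 < L)
    (hEfin : groundStateEnergy v (n + 1) L ≠ ⊤) {C : ℝ} (hC0 : 0 ≤ C) {T₁ : ℝ} (hT₁ : 1 ≤ T₁)
    (hrat : ∀ T : ℝ, T₁ ≤ T →
      ∫⁻ Y : Config n, ENNReal.ofReal (L ^ 3) *
        (∫⁻ x, (‖fkWitness (N := n + 1) v L T (fun _ => (1 : ℝ≥0∞)) (Matrix.vecCons x Y)‖₊ :
          ℝ≥0∞) ^ 2) ^ 2 /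
        (∫⁻ x, (‖fkWitness (N := n + 1) v L T (fun _ => (1 : ℝ≥0∞)) (Matrix.vecCons x Y)‖₊ :
          ℝ≥0∞)) ^ 2 ≤ ENNReal.ofReal C)
    {δ : ℝ≥0∞} (hδ : 0 < δ),
    ∃ Ψ : TrialState (n + 1) L,
      energy v Ψ ≤ groundStateEnergy v (n + 1) L + δ ∧ (∀ X, Ψ.ψ X = (‖Ψ.ψ X‖ : ℂ)) ∧
      ∫⁻ Y : Config n, ENNReal.ofReal (L ^ 3) *
        (∫⁻ x, (‖Ψ.ψ (Matrix.vecCons x Y)‖₊ : ℝ≥0∞) ^ 2) ^ 2 /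
          (∫⁻ x, (‖Ψ.ψ (Matrix.vecCons x Y)‖₊ : ℝ≥0∞)) ^ 2 ≤ ENNReal.ofReal (C + 1)

end Goal

/-- **PROVED toolbox stub `stub_glueLandscapeAtLate`: the landscape witness at late polymer length,
fixed `(n, L, δ)`** — `T = max T₁ (2ℓ/δ + 1)`, then truncation, margins and mollification exactly as
in `glue_landscape_at`. [folklore] -/
theorem stub_glueLandscapeAtLate : Goal.stub_glueLandscapeAtLate := by
  intro HB HC HE1a HE1b HF v hv HE2 n L hL hEfin C hC0 T₁ hT₁ hrat δ hδ
  have hvm : Measurable v := hv.1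
  set Z : ℝ → ℝ≥0∞ := fun T => fkNormSq (N := n + 1) v L T (fun _ => 1) with hZdef
  obtain ⟨c, hc, hZ⟩ := HC hvm hL (Nat.le_add_left 1 n) hEfin
  have hZne : ∀ T : ℝ, 0 ≤ T → Z T ≠ 0 := fun T hT h0 => by
    have h1 := hZ T hT
    rw [show fkNormSq (N := n + 1) v L T (fun _ => 1) = Z T from rfl, h0, nonpos_iff_eq_zero,
      ENNReal.ofReal_eq_zero] at h1
    exact absurd h1 (not_le.2 (mul_pos hc (Real.exp_pos _)))
  have hZtop : ∀ T : ℝ, 0 ≤ T → Z T ≠ ⊤ := fun T hT =>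
    ne_top_of_le_ne_top (volume_boxN_lt_top (n + 1) L).ne (fkNormSq_one_le v hT)
  have hZle0 : ∀ T : ℝ, 0 ≤ T → Z T ≤ Z 0 := fun T hT => by
    calc Z T ≤ volume (boxN (n + 1) L) := fkNormSq_one_le v hT
      _ = Z 0 := by
          show volume (boxN (n + 1) L) = fkNormSq (N := n + 1) v L 0 (fun _ => 1)
          rw [fkNormSq_zero]; simp
  set δ' : ℝ≥0∞ := min δ 1 with hδ'def
  have hδ'0 : δ' ≠ 0 := (lt_min hδ one_pos).ne'
  have hδ'top : δ' ≠ ⊤ := ne_top_of_le_ne_top ENNReal.one_ne_top (min_le_right _ _)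
  set δr : ℝ := δ'.toReal with hδrdef
  have hδr : 0 < δr := ENNReal.toReal_pos hδ'0 hδ'top
  have hδrδ : ENNReal.ofReal δr ≤ δ := by rw [hδrdef, ENNReal.ofReal_toReal hδ'top]; exact min_le_left _ _
  set E₀ : ℝ≥0∞ := groundStateEnergy v (n + 1) L with hE₀def
  set E₀r : ℝ := E₀.toReal with hE₀rdef
  have hE₀r : 0 ≤ E₀r := ENNReal.toReal_nonneg
  have hE₀eq : E₀ = ENNReal.ofReal E₀r := (ENNReal.ofReal_toReal hEfin).symm
  set Z0r : ℝ := (Z 0).toReal with hZ0rdef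
  have hZ0r : 0 < Z0r := ENNReal.toReal_pos (hZne 0 le_rfl) (hZtop 0 le_rfl)
  set ℓ : ℝ := max (Real.log (Z0r / c)) 0 with hℓdef
  have hℓ0 : 0 ≤ ℓ := le_max_right _ _
  set T : ℝ := max T₁ (2 * ℓ / δr + 1) with hTdef
  have hTT₁ : T₁ ≤ T := le_max_left _ _
  have hT1 : 1 ≤ T := hT₁.trans hTT₁
  have hT0 : 0 < T := one_pos.trans_le hT1
  have hTℓ : 2 * ℓ ≤ T * δr := by
    have h1 : 2 * ℓ / δr + 1 ≤ T := le_max_right _ _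
    have h2 : 2 * ℓ / δr ≤ T := by linarith
    rwa [div_le_iff₀ hδr] at h2
  set ZTr : ℝ := (Z T).toReal with hZTrdef
  have hZTr : 0 < ZTr := ENNReal.toReal_pos (hZne T hT0.le) (hZtop T hT0.le)
  have hZTr_le : ZTr ≤ Z0r := ENNReal.toReal_mono (hZtop 0 le_rfl) (hZle0 T hT0.le)
  have hcZ : c * Real.exp (-(2 * E₀r * T)) ≤ ZTr := by
    have h1 := hZ T hT0.le
    have h2 := ENNReal.toReal_mono (hZtop T hT0.le) h1
    rwa [ENNReal.toReal_ofReal (mul_pos hc (Real.exp_pos _)).le] at h2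
  set E : ℝ := Real.log (Z0r / ZTr) / (2 * T) with hEdef
  have hE0 : 0 ≤ E := by
    rw [hEdef]
    exact div_nonneg (Real.log_nonneg ((one_le_div hZTr).2 hZTr_le)) (by positivity)
  have hE_le : E ≤ E₀r + δr / 4 := by
    have h1 : Real.log (Z0r / ZTr) ≤ ℓ + 2 * E₀r * T := by
      have h2 : Z0r / ZTr ≤ Z0r / (c * Real.exp (-(2 * E₀r * T))) :=
        div_le_div_of_nonneg_left hZ0r.le (mul_pos hc (Real.exp_pos _)) hcZ
      calc Real.log (Z0r / ZTr) ≤ Real.log (Z0r / (c * Real.exp (-(2 * E₀r * T)))) :=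
            Real.log_le_log (div_pos hZ0r hZTr) h2
        _ = Real.log (Z0r / c) + 2 * E₀r * T := by
            rw [div_mul_eq_div_div, Real.log_div (div_pos hZ0r hc).ne' (Real.exp_pos _).ne',
              Real.log_exp]
            ring
        _ ≤ ℓ + 2 * E₀r * T := by gcongr; exact le_max_left _ _
    rw [hEdef, div_le_iff₀ (by positivity)]
    nlinarith
  have heig : ∀ t : ℝ, 0 < t → Real.exp (-(E * t)) ≤
      ∫ X, fkWitness (N := n + 1) v L T (fun _ => (1 : ℝ≥0∞)) X *
        fkReal v L t (fkWitness (N := n + 1) v L T (fun _ => (1 : ℝ≥0∞))) X :=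
    fun t ht => HB hvm L hT0 (hZne T hT0.le) ht
  set Ψ : Config (n + 1) → ℝ := fkWitness (N := n + 1) v L T (fun _ => (1 : ℝ≥0∞)) with hΨdef
  have hΨm : Measurable Ψ := measurable_fkWitness hvm L T measurable_const
  have hΨnn : ∀ X, 0 ≤ Ψ X := fkWitness_nonneg v L T _
  have hΨ0 : ∀ X, X ∉ boxN (n + 1) L → Ψ X = 0 := fun X hX => fkWitness_of_notMem v hT0.le _ hX
  set MΨ : ℝ := (Real.sqrt ZTr)⁻¹ with hMΨdef
  have hΨapply : ∀ X, Ψ X = (fkSemigroup v L T (fun _ => (1 : ℝ≥0∞)) X).toReal / Real.sqrt ZTr :=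
    fun X => rfl
  have hΨbd : ∀ X, |Ψ X| ≤ MΨ := fun X => by
    rw [abs_of_nonneg (hΨnn X), hΨapply, hMΨdef, div_eq_mul_inv]
    refine mul_le_of_le_one_left (inv_nonneg.2 (Real.sqrt_nonneg _)) ?_
    exact ENNReal.toReal_le_of_le_ofReal zero_le_one (by
      rw [ENNReal.ofReal_one]; exact fkPartition_le_one v L T X)
  have hΨnorm : ∫ X, Ψ X ^ 2 = 1 := by
    have h1 := lintegral_fkWitness_sq hvm L T (measurable_const : Measurable fun _ : Config (n + 1) =>
      (1 : ℝ≥0∞)) (hZne T hT0.le) (hZtop T hT0.le)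
    rw [integral_eq_lintegral_of_nonneg_ae (Eventually.of_forall fun X => sq_nonneg _)
      ((hΨm.pow_const 2).aestronglyMeasurable)]
    have h2 : ∫⁻ X, ENNReal.ofReal (Ψ X ^ 2) = 1 := by
      rw [← h1]; refine lintegral_congr fun X => ?_
      rw [ENNReal.ofReal_pow (hΨnn X)]
    rw [h2, ENNReal.toReal_one]
  have hΨsymm : ∀ (σ : Equiv.Perm (Fin (n + 1))) (X : Config (n + 1)), Ψ (X ∘ σ) = Ψ X :=
    fun σ X => fkWitness_comp_perm σ hvm L T measurable_const (fun _ => rfl) X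
  obtain ⟨hI, hev⟩ := HE1a hvm hL hΨm hΨbd hΨnn hΨ0 hΨnorm heig
  set I : ℝ≥0∞ := ∫⁻ X, ENNReal.ofReal (Ψ X ^ 2) * interaction v X with hIdef
  have hItop : I ≠ ⊤ := ne_top_of_le_ne_top ENNReal.ofReal_ne_top hI
  have hIE : I.toReal ≤ E := ENNReal.toReal_le_of_le_ofReal hE0 hI
  set K : ℝ := E - I.toReal with hKdef
  have hK : 0 ≤ K := by rw [hKdef]; linarith
  set θ : ℝ := (δr / 2) / (E₀r + δr / 2) with hθdef
  have hθ0 : 0 < θ := by rw [hθdef]; positivity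
  set τ : ℝ := min (θ / 4) (1 / (8 * (C + 1))) with hτdef
  have hτ0 : 0 < τ := lt_min (by positivity) (by positivity)
  have hτθ : τ ≤ θ / 4 := min_le_left _ _
  have hτC : τ ≤ 1 / (8 * (C + 1)) := min_le_right _ _
  have hτ4 : τ ≤ 1 / 4 := by
    refine hτC.trans ?_
    rw [div_le_div_iff₀ (by positivity) (by norm_num)]; nlinarith
  set f : ℝ → Config (n + 1) → ℝ := fun η X => max (Ψ X - η) 0 with hfdef
  have hfm : ∀ η, Measurable (f η) := fun η => (hΨm.sub measurable_const).max measurable_const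
  have hfnn : ∀ η X, 0 ≤ f η X := fun η X => le_max_right _ _
  have hfle : ∀ η, 0 < η → ∀ X, f η X ≤ Ψ X := fun η hη X =>
    max_le (by linarith [hΨnn X]) (hΨnn X)
  have hfbd : ∀ η, 0 < η → ∀ X, |f η X| ≤ MΨ := fun η hη X => by
    rw [abs_of_nonneg (hfnn η X)]
    exact (hfle η hη X).trans ((le_abs_self _).trans (hΨbd X))
  have hf0 : ∀ η, 0 < η → ∀ X, X ∉ boxN (n + 1) L → f η X = 0 := fun η hη X hX => by
    show max (Ψ X - η) 0 = 0
    rw [hΨ0 X hX, max_eq_right (by linarith)]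
  have hfsymm : ∀ η (σ : Equiv.Perm (Fin (n + 1))) (X : Config (n + 1)), f η (X ∘ σ) = f η X :=
    fun η σ X => by show max (Ψ (X ∘ σ) - η) 0 = max (Ψ X - η) 0; rw [hΨsymm σ X]
  have hfne : ∀ η X, f η X ≠ 0 → η < Ψ X := fun η X hX => by
    by_contra hle
    exact hX (max_eq_right (by linarith [not_lt.1 hle]))
  have hfsq_le : ∀ η, 0 < η → ∀ X, ENNReal.ofReal (f η X ^ 2) ≤ ENNReal.ofReal (Ψ X ^ 2) :=
    fun η hη X => ENNReal.ofReal_le_ofReal (pow_le_pow_left₀ (hfnn η X) (hfle η hη X) 2)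
  have hratΨ := hrat T hTT₁
  have hCtop : ENNReal.ofReal C ≠ ⊤ := ENNReal.ofReal_ne_top
  set e5 : ℝ≥0∞ := ENNReal.ofReal (1 / (16 * (C + 1))) with he5def
  have he5 : 0 < e5 := ENNReal.ofReal_pos.2 (by positivity)
  have h1 : ∀ᶠ η in 𝓝[>] (0 : ℝ), 1 - τ < ∫ X, f η X ^ 2 := by
    have ht := glue_tendsto_integral_posPart_sq (L := L) hΨm hΨbd hΨnn hΨ0
    rw [hΨnorm] at ht
    exact (tendsto_order.1 ht).1 _ (by linarith)
  have h2 : ∀ᶠ η in 𝓝[>] (0 : ℝ), ∫⁻ Y : Config n, ENNReal.ofReal (L ^ 3) *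
      (∫⁻ x, (‖f η (Matrix.vecCons x Y)‖₊ : ℝ≥0∞) ^ 2) ^ 2 /
        (∫⁻ x, (‖f η (Matrix.vecCons x Y)‖₊ : ℝ≥0∞)) ^ 2 < ENNReal.ofReal C + e5 := by
    have ht := glue_tendsto_ratio_posPart (L := L) hΨm hΨbd hΨnn hΨ0
    exact (tendsto_order.1 ht).2 _ (lt_of_le_of_lt hratΨ (ENNReal.lt_add_right hCtop he5.ne'))
  obtain ⟨η, ⟨h1η, h2η⟩, hη⟩ := ((h1.and h2).and self_mem_nhdsWithin).exists
  have hη' : (0 : ℝ) < η := hη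
  set ηw : ℝ := η * Real.sqrt ZTr / 2 with hηwdef
  have hηw : 0 < ηw := by rw [hηwdef]; exact div_pos (mul_pos hη' (Real.sqrt_pos.2 hZTr)) two_pos
  obtain ⟨κw, hκw, Hw⟩ := glue_wall_vanish (N := n + 1) v L hT0 hηw
  obtain ⟨κh, hκh, Hh⟩ := HE2 (N := n + 1) L hT0 hηw
  have hbig : ∀ X, f η X ≠ 0 → ENNReal.ofReal ηw < fkSemigroup v L T (fun _ => (1 : ℝ≥0∞)) X := by
    intro X hX
    have hlt := hfne η X hX
    rw [hΨapply, lt_div_iff₀ (Real.sqrt_pos.2 hZTr)] at hlt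
    have hlt' : ηw < (fkSemigroup v L T (fun _ => (1 : ℝ≥0∞)) X).toReal := by
      rw [hηwdef]; linarith [mul_pos hη' (Real.sqrt_pos.2 hZTr)]
    exact (ENNReal.ofReal_lt_iff_lt_toReal hηw.le
      ((fkPartition_le_one v L T X).trans_lt ENNReal.one_lt_top).ne).2 hlt'
  have hwall : ∀ X, f η X ≠ 0 → ∀ i k, κw ≤ X i k ∧ X i k ≤ L - κw := by
    intro X hX i k
    by_contra hcon
    have h' : ∃ i k, X i k < κw ∨ L - κw < X i k := by
      refine ⟨i, k, ?_⟩
      rcases not_and_or.1 hcon with h | h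
      · exact Or.inl (not_le.1 h)
      · exact Or.inr (not_le.1 h)
    exact absurd (Hw X h') (not_le.2 (hbig X hX))
  have hhard : ∀ X, f η X ≠ 0 → ∀ i j : Fin (n + 1), i ≠ j → ∀ z ∈ hardVec v,
      κh ≤ dist (X i - X j) z := by
    intro X hX i j hij z hz
    by_contra hcon
    exact absurd (Hh X ⟨i, j, hij, z, hz, not_le.1 hcon⟩) (not_le.2 (hbig X hX))
  set r₀ : ℝ := min κw κh / 4 with hr₀def
  have hr₀ : 0 < r₀ := by rw [hr₀def]; exact div_pos (lt_min hκw hκh) four_pos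
  have hr₀w : r₀ ≤ κw / 4 := by rw [hr₀def]; gcongr; exact min_le_left _ _
  have hr₀h : r₀ ≤ κh / 4 := by rw [hr₀def]; gcongr; exact min_le_right _ _
  set S : Set (Config (n + 1)) := {X | (∀ i k, κw / 2 ≤ X i k ∧ X i k ≤ L - κw / 2) ∧
    ∀ i j : Fin (n + 1), i ≠ j → ∀ z ∈ hardVec v, κh / 2 ≤ dist (X i - X j) z} with hSdef
  have hcoord : ∀ (i : Fin (n + 1)) (k : Fin 3), Continuous fun X : Config (n + 1) => X i k :=
    fun i k => (EuclideanSpace.proj k).continuous.comp (continuous_apply i)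
  have hSclosed : IsClosed S := by
    have h1 : IsClosed {X : Config (n + 1) | ∀ i k, κw / 2 ≤ X i k ∧ X i k ≤ L - κw / 2} := by
      simp only [Set.setOf_forall]
      exact isClosed_iInter fun i => isClosed_iInter fun k =>
        (isClosed_le continuous_const (hcoord i k)).inter (isClosed_le (hcoord i k) continuous_const)
    have h2 : IsClosed {X : Config (n + 1) | ∀ i j : Fin (n + 1), i ≠ j → ∀ z ∈ hardVec v,
        κh / 2 ≤ dist (X i - X j) z} := by
      simp only [Set.setOf_forall]
      refine isClosed_iInter fun i => isClosed_iInter fun j => isClosed_iInter fun _ =>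
        isClosed_iInter fun z => isClosed_iInter fun _ => ?_
      exact isClosed_le continuous_const
        ((((continuous_apply i).sub (continuous_apply j))).dist continuous_const)
    exact h1.inter h2
  have hSm : MeasurableSet S := hSclosed.measurableSet
  have hSbox : S ⊆ boxN (n + 1) L := by
    intro X hX i k
    have h := hX.1 i k
    constructor <;> linarith [h.1, h.2]
  have hcoord_le : ∀ (Y X : Config (n + 1)) (i : Fin (n + 1)) (k : Fin 3),
      |Y i k - X i k| ≤ dist Y X := by
    intro Y X i k
    calc |Y i k - X i k| = dist (Y i k) (X i k) := (Real.dist_eq _ _).symm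
      _ ≤ dist (Y i) (X i) := by
          rw [EuclideanSpace.dist_eq]
          refine Real.le_sqrt_of_sq_le ?_
          exact Finset.single_le_sum (f := fun l => dist (Y i l) (X i l) ^ 2)
            (fun _ _ => sq_nonneg _) (Finset.mem_univ k)
      _ ≤ dist Y X := dist_le_pi_dist Y X i
  have hmargin : ∀ X, f η X ≠ 0 → Metric.closedBall X r₀ ⊆ S := by
    intro X hX Y hY
    rw [Metric.mem_closedBall] at hY
    refine ⟨fun i k => ?_, fun i j hij z hz => ?_⟩
    · have h := hwall X hX i k
      have hc := hcoord_le Y X i k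
      rw [abs_le] at hc
      constructor <;> linarith [hc.1, hc.2]
    · have h := hhard X hX i j hij z hz
      have hYX : dist X Y ≤ r₀ := by rwa [dist_comm] at hY
      have hd : dist (X i - X j) z ≤ dist (X i - X j) (Y i - Y j) + dist (Y i - Y j) z :=
        dist_triangle _ _ _
      have hd2 : dist (X i - X j) (Y i - Y j) ≤ dist (X i) (Y i) + dist (X j) (Y j) :=
        dist_sub_sub_le _ _ _ _
      have hi : dist (X i) (Y i) ≤ dist X Y := dist_le_pi_dist X Y i
      have hj : dist (X j) (Y j) ≤ dist X Y := dist_le_pi_dist X Y j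
      linarith
  have hSV : ∫⁻ X in S, interaction v X ≠ ⊤ :=
    glue_setLIntegral_interaction_ne_top hv (half_pos hκh) hSm hSbox (fun X hX => hX.2)
  have hev_f : ∀ ε : ℝ, 0 < ε → ∀ᶠ t : ℝ≥0 in 𝓝[>] 0,
      (ENNReal.ofReal (2 * t))⁻¹ * sqIncr t (f η) ≤ ENNReal.ofReal (K + ε) := fun ε hε =>
    (hev ε hε).mono fun t ht =>
      (mul_le_mul_right (glue_sqIncr_posPart_sub_le Ψ η t) _).trans (by rwa [hKdef])
  have hq : 1 - τ ≤ ∫ X, f η X ^ 2 := h1η.le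
  have hpos_f : 0 < ∫ X, f η X ^ 2 := by linarith
  set εb : ℝ := min τ (δr / 8) with hεbdef
  have hεb : 0 < εb := lt_min hτ0 (by positivity)
  obtain ⟨r₁, hr₁, HΦ⟩ := HE1b hvm hL (hfm η) (hfbd η hη') (hfnn η) (hfsymm η) hpos_f hSm hSbox
    hr₀ hmargin hSV hK hev_f hεb
  have hFr := HF (n := n) (L := L) (hfm η) (hfbd η hη') (hfnn η) hr₀
    (fun X hX => (hmargin X hX).trans hSbox) he5
  have hr1ev : ∀ᶠ r in 𝓝[>] (0 : ℝ), r ∈ Set.Ioo 0 r₁ := Ioo_mem_nhdsGT hr₁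
  obtain ⟨r, hrF, hr0, hrr₁⟩ := (hFr.and_eventually hr1ev).exists
  obtain ⟨cc, Φ, hcc, hcq, hΦψ, hΦE⟩ := HΦ r hr0 hrr₁
  have hrFr := hrF hr0
  have hΦX : ∀ X, Φ.ψ X = (((cc * mollify hr0 (f η) X : ℝ)) : ℂ) := fun X => by rw [hΦψ]
  have hg0 : ∀ X, 0 ≤ mollify hr0 (f η) X := fun X => mollify_nonneg hr0 (hfnn η) X
  have hεbτ : εb ≤ τ := min_le_left _ _
  have hεbδ : εb ≤ δr / 8 := min_le_right _ _
  have hcc2 : 0 ≤ cc ^ 2 := sq_nonneg _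
  refine ⟨Φ, ?_, ?_, ?_⟩
  · -- energy
    have hVf : (∫⁻ X, ENNReal.ofReal (f η X ^ 2) * interaction v X) ≤ I :=
      lintegral_mono fun X => mul_le_mul_left (hfsq_le η hη' X) _
    have hsum : ENNReal.ofReal K + I + ENNReal.ofReal εb = ENNReal.ofReal (E + εb) := by
      rw [← ENNReal.ofReal_toReal hItop, ← ENNReal.ofReal_add hK ENNReal.toReal_nonneg,
        ← ENNReal.ofReal_add (by positivity) hεb.le]
      congr 1; rw [hKdef]; ring
    have harith : cc ^ 2 * (E + εb) ≤ E₀r + δr :=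
      glue_arith_energy hE₀r hδr rfl hτ0 hτθ hτ4 hE_le hE0 hεb.le hεbδ hεbτ hq hcc2 hcq
    calc energy v Φ ≤ ENNReal.ofReal (cc ^ 2) * (ENNReal.ofReal K +
          (∫⁻ X, ENNReal.ofReal (f η X ^ 2) * interaction v X) + ENNReal.ofReal εb) := hΦE
      _ ≤ ENNReal.ofReal (cc ^ 2) * (ENNReal.ofReal K + I + ENNReal.ofReal εb) := by gcongr
      _ = ENNReal.ofReal (cc ^ 2 * (E + εb)) := by
          rw [hsum, ← ENNReal.ofReal_mul hcc2]
      _ ≤ ENNReal.ofReal (E₀r + δr) := ENNReal.ofReal_le_ofReal harith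
      _ = E₀ + ENNReal.ofReal δr := by rw [ENNReal.ofReal_add hE₀r hδr.le, ← hE₀eq]
      _ ≤ E₀ + δ := by gcongr
  · -- nonnegativity
    intro X
    rw [hΦX X]
    have h0 : 0 ≤ cc * mollify hr0 (f η) X := mul_nonneg hcc.le (hg0 X)
    rw [Complex.norm_real, Real.norm_of_nonneg h0]
  · -- ratio
    have hratio : ∫⁻ Y : Config n, ENNReal.ofReal (L ^ 3) *
        (∫⁻ x, (‖Φ.ψ (Matrix.vecCons x Y)‖₊ : ℝ≥0∞) ^ 2) ^ 2 /
          (∫⁻ x, (‖Φ.ψ (Matrix.vecCons x Y)‖₊ : ℝ≥0∞)) ^ 2 =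
        ENNReal.ofReal (cc ^ 2) * ∫⁻ Y : Config n, ENNReal.ofReal (L ^ 3) *
          (∫⁻ x, (‖mollify hr0 (f η) (Matrix.vecCons x Y)‖₊ : ℝ≥0∞) ^ 2) ^ 2 /
            (∫⁻ x, (‖mollify hr0 (f η) (Matrix.vecCons x Y)‖₊ : ℝ≥0∞)) ^ 2 := by
      rw [← lintegral_ratio_const_mul L (mollify hr0 (f η)) hcc.ne']
      simp_rw [hΦX, Complex.nnnorm_real]
    rw [hratio]
    have he55 : e5 + e5 = ENNReal.ofReal (1 / (8 * (C + 1))) := by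
      rw [he5def, ← ENNReal.ofReal_add (by positivity) (by positivity)]
      congr 1; field_simp; ring
    have harith : cc ^ 2 * (C + 1 / (8 * (C + 1))) ≤ C + 1 :=
      glue_arith_ratio hC0 hτ0 hτC hεbτ hq hcc2 hcq
    calc ENNReal.ofReal (cc ^ 2) * ∫⁻ Y : Config n, ENNReal.ofReal (L ^ 3) *
          (∫⁻ x, (‖mollify hr0 (f η) (Matrix.vecCons x Y)‖₊ : ℝ≥0∞) ^ 2) ^ 2 /
            (∫⁻ x, (‖mollify hr0 (f η) (Matrix.vecCons x Y)‖₊ : ℝ≥0∞)) ^ 2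
        ≤ ENNReal.ofReal (cc ^ 2) * (ENNReal.ofReal C + e5 + e5) := by
          gcongr
          exact hrFr.trans (by gcongr)
      _ = ENNReal.ofReal (cc ^ 2 * (C + 1 / (8 * (C + 1)))) := by
          rw [add_assoc, he55, ← ENNReal.ofReal_add hC0 (by positivity), ← ENNReal.ofReal_mul hcc2]
      _ ≤ ENNReal.ofReal (C + 1) := ENNReal.ofReal_le_ofReal harith

end Summit.AtomisticToContinuum.BoseEinsteinCondensation.Cruxes.TwoReplicaTransienceBound.LateCoreSplit

end
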